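import Mathlib.RingTheory.Regular.RegularSequence
import Mathlib.RingTheory.Localization.AtPrime.Basic
import Mathlib.RingTheory.LocalProperties.Basic
import Mathlib.RingTheory.KrullDimension.Basic
import Mathlib.Algebra.CharP.Algebra
import Mathlib.Algebra.CharP.Lemmas
import Literature.RingTheory.TightClosure.TightClosure
import Summits.ResolutionOfSingularities.ResolutionOfSingularities.Theorems.FrobeniusLadderFInjectiveMacaulayficationPartialSop
import Summits.ResolutionOfSingularities.ResolutionOfSingularities.Theorems.FrobeniusLadderFInjectiveMacaulayficationExtendSop
import Summits.ResolutionOfSingularities.ResolutionOfSingularities.Theorems.FrobeniusLadderFInjectiveMacaulayficationRetractClause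
import Literature.RingTheory.Flat.RegularSequenceBaseChange
import HarnessLib

/-!
# Degree-zero descent of the Cohen–Macaulay + F-injective clause along a retraction

Support file for crux stmt-ResolutionOfSingularities-15315 (`FrobeniusLadder.FInjectiveMacaulayfication`,
line `Sketch`, lead seat c3, cycle 4). It assembles the cycle-4 helper stubs
(`PartialSop.stub_partialSop` p133894, `ExtendSop.stub_extendSop` p133856,
`RetractClause.stub_clauseOfRetract` p133979; companions `RetractRegular.stub_retractRegular` p133804 and
`GradedZero.stub_projZeroRetract` p133911) into the ENGINE that step (ii) of the crux card
`weighted-cone-deformation-descent` asks for — "degree-zero descent" of the crux's per-stalk clause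
(every system of parameters a weakly regular sequence generating a Frobenius closed ideal) from a ring `B`
to a subring `A` along an `A`-linear retraction `ρ : B → A` — made purely IDEAL-THEORETIC: no local
cohomology, no F-finiteness, no flatness of `A → B`, any prime characteristic, any weights.

* `clause_of_retract` (§3): `A` Noetherian local of characteristic `p`, `B` Noetherian, `s : Fin d → A`.
  If at every maximal ideal `P ⊇ (s)B` the local ring `B_P` satisfies the clause and `dim B_P = d + e`,
  `dim B_P/(s) = e`, and at the maximal ideals `P ⊉ (s)B` the images of `s` are still weakly regular, then
  `s` is weakly regular on `A` and `(s)A` is Frobenius closed. `inlineClause_of_retract`: hence the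
  crux's clause for `A`, verbatim.
* The LOCALIZED form one actually meets on a blow-up chart (`A = T₀ ⊆ T = B` a `ℤ`-graded ring, `n` a
  prime of `T₀`: the clause for `A_n` from the local rings `B_Q` at the primes `Q` of `B` maximal among
  those with `Q ∩ A ⊆ n`) is the sequel file `…DegreeZeroDescentLocal.lean`
  (`inlineClause_localization_of_retract`).
* §1–§2: bookkeeping — inline clause ⇒ `IsSystemOfParameters` form, characteristic of localizations, the
  pointwise suppliers `images_clause_of_extends` / `images_clause_of_ringKrullDim` /
  `images_clause_of_isUnit`.

Together with E1 (`Deformation.cmfi_of_cmfi_quotient`, p132502: deform from `A'/t⁻¹A' = gr`) this is the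
card's Proposition modulo the pure blow-up bookkeeping of the extended Rees algebra (`t⁻¹ ∈ √(𝔫T)` on the
exceptional locus, `dim T_𝔓 = d + 1`), which needs the extended Rees algebra as an object and is left to
the line that adopts the card. The card's cheapest falsifier (a) — "a `ℤ`-graded CMFI ring `T` whose `T₀`
is not F-injective" — is thereby EXCLUDED whenever the dimension bookkeeping holds (a theorem, not a search).

References: Fedder 1983 (Trans. AMS 278) Thm 3.4; Horiuchi–Miller–Shimomoto arXiv:1210.3589 §1;
Quy–Shimomoto arXiv:1601.02524 §3 (CM: F-injective ⇔ parameter ideals Frobenius closed).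
-/

-- single-problem summit: the doubled namespace component is forced
set_option linter.dupNamespace false

namespace Summit.ResolutionOfSingularities.ResolutionOfSingularities.Theorems.FInjectiveMacaulayfication.DegreeZeroDescent

open IsLocalRing RingTheory.Sequence Literature.RingTheory.TightClosure

/-! ## §1 From the crux's inline clause to the `IsSystemOfParameters` form -/

variable (p : ℕ) [Fact p.Prime]

/-- Inline form (verbatim the per-stalk predicate of `FrobeniusLadder.FInjectiveMacaulayfication`) ⇒
`IsSystemOfParameters`/`IsFrobeniusClosed` form of the clause. [folklore] -/
theorem sopClause_of_inlineClause {L : Type} [CommRing L] [IsLocalRing L] [CharP L p]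
    (h : ∀ d : ℕ, ringKrullDim L = d → ∀ s : Fin d → L, (Ideal.span (Set.range s)).radical.IsMaximal →
      IsWeaklyRegular L (List.ofFn s) ∧
      ∀ y : L, (∃ e : ℕ, y ^ p ^ e ∈ Ideal.span ((fun z : L => z ^ p ^ e) ''
        (Ideal.span (Set.range s) : Set L))) → y ∈ Ideal.span (Set.range s)) :
    ∀ ⦃n : ℕ⦄ (u : Fin n → L), IsSystemOfParameters u →
      IsWeaklyRegular L (List.ofFn u) ∧ IsFrobeniusClosed p (Ideal.span (Set.range u)) := by
  intro n u hu
  obtain ⟨hd, hrad⟩ := (isSystemOfParameters_iff).mp hu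
  obtain ⟨hW, hF⟩ := h n hd u hrad
  exact ⟨hW, (isFrobeniusClosed_iff p).mpr hF⟩

/-- A localization of a ring of prime characteristic `p` at a prime ideal has characteristic `p` (it is a
non-trivial ring in which `p = 0`). [folklore] -/
theorem charP_localization_atPrime {B : Type} [CommRing B] [CharP B p] (P : Ideal B) [P.IsPrime] :
    CharP (Localization.AtPrime P) p := by
  have hp : (p : Localization.AtPrime P) = 0 := by
    rw [← map_natCast (algebraMap B (Localization.AtPrime P)) p, CharP.cast_eq_zero, map_zero]
  exact (CharP.charP_iff_prime_eq_zero Fact.out).mpr hp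

/-! ## §2 Pointwise suppliers: the hypothesis of `stub_clauseOfRetract` at a maximal ideal `P` -/

/-- At a Noetherian local ring `L` of characteristic `p` satisfying the clause (inline form), the images `s'`
form a weakly regular sequence and generate a Frobenius closed ideal as soon as they EXTEND to a system of
parameters of `L` (`stub_partialSop`). [folklore] -/
theorem images_clause_of_extends {L : Type} [CommRing L] [IsNoetherianRing L] [IsLocalRing L] [CharP L p]
    (hL : ∀ d : ℕ, ringKrullDim L = d → ∀ s : Fin d → L, (Ideal.span (Set.range s)).radical.IsMaximal →
      IsWeaklyRegular L (List.ofFn s) ∧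
      ∀ y : L, (∃ e : ℕ, y ^ p ^ e ∈ Ideal.span ((fun z : L => z ^ p ^ e) ''
        (Ideal.span (Set.range s) : Set L))) → y ∈ Ideal.span (Set.range s))
    {d e : ℕ} (s' : Fin d → L) (t : Fin e → L) (hst : IsSystemOfParameters (Fin.append s' t)) :
    IsWeaklyRegular L (List.ofFn s') ∧
      ∀ y : L, (∃ e : ℕ, y ^ p ^ e ∈ Ideal.span ((fun z : L => z ^ p ^ e) ''
        (Ideal.span (Set.range s') : Set L))) → y ∈ Ideal.span (Set.range s') := by
  obtain ⟨hW, hF⟩ := PartialSop.stub_partialSop p L (sopClause_of_inlineClause p hL) d e s' t hst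
  exact ⟨hW, (isFrobeniusClosed_iff p).mp hF⟩

/-- Dimension form of `images_clause_of_extends`: `dim L = d + e` and `dim L/(s') = e` suffice
(`stub_extendSop`). [folklore] -/
theorem images_clause_of_ringKrullDim {L : Type} [CommRing L] [IsNoetherianRing L] [IsLocalRing L]
    [CharP L p]
    (hL : ∀ d : ℕ, ringKrullDim L = d → ∀ s : Fin d → L, (Ideal.span (Set.range s)).radical.IsMaximal →
      IsWeaklyRegular L (List.ofFn s) ∧
      ∀ y : L, (∃ e : ℕ, y ^ p ^ e ∈ Ideal.span ((fun z : L => z ^ p ^ e) ''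
        (Ideal.span (Set.range s) : Set L))) → y ∈ Ideal.span (Set.range s))
    {d : ℕ} (e : ℕ) (s' : Fin d → L)
    (hdim : ringKrullDim L = ((d + e : ℕ) : WithBot ℕ∞))
    (hquot : ringKrullDim (L ⧸ Ideal.span (Set.range s')) = (e : WithBot ℕ∞)) :
    IsWeaklyRegular L (List.ofFn s') ∧
      ∀ y : L, (∃ e : ℕ, y ^ p ^ e ∈ Ideal.span ((fun z : L => z ^ p ^ e) ''
        (Ideal.span (Set.range s') : Set L))) → y ∈ Ideal.span (Set.range s') := by
  obtain ⟨t, ht⟩ := ExtendSop.stub_extendSop L d e s' hdim hquot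
  exact images_clause_of_extends p hL s' t ht

omit [Fact (Nat.Prime p)] in
/-- Off `V((s))`: if the image `v` is a unit of `L` and the images `u` before it form a weakly regular
sequence, then the whole sequence `u, v, w` is weakly regular on `L` (after a unit the module is zero) and
the ideal it generates is `L`, trivially Frobenius closed. [folklore] -/
theorem images_clause_of_isUnit {L : Type} [CommRing L] {a b : ℕ} (u : Fin a → L) (v : L) (w : Fin b → L)
    (hu : IsWeaklyRegular L (List.ofFn u)) (hv : IsUnit v) :
    IsWeaklyRegular L (List.ofFn (Fin.append u (Fin.cons v w : Fin (b + 1) → L))) ∧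
      ∀ y : L, (∃ e : ℕ, y ^ p ^ e ∈ Ideal.span ((fun z : L => z ^ p ^ e) ''
        (Ideal.span (Set.range (Fin.append u (Fin.cons v w : Fin (b + 1) → L))) : Set L))) →
        y ∈ Ideal.span (Set.range (Fin.append u (Fin.cons v w : Fin (b + 1) → L))) := by
  refine ⟨?_, fun y _ => ?_⟩
  · rw [List.ofFn_fin_append, List.ofFn_cons, isWeaklyRegular_append_iff]
    refine ⟨hu, ?_⟩
    rw [isWeaklyRegular_cons_iff]
    refine ⟨hv.isSMulRegular _, ?_⟩
    haveI : Subsingleton (QuotSMulTop v (L ⧸ (Ideal.ofList (List.ofFn u) • ⊤ : Submodule L L))) := by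
      refine Submodule.Quotient.subsingleton_iff.mpr (eq_top_iff.mpr fun x _ => ?_)
      obtain ⟨c, rfl⟩ := hv
      have hx : x = (c : L) • ((c⁻¹ : Lˣ) : L) • x := by
        rw [smul_smul, Units.mul_inv, one_smul]
      rw [hx]
      exact Submodule.smul_mem_pointwise_smul _ _ _ Submodule.mem_top
    exact Literature.RingTheory.Flat.isWeaklyRegular_of_subsingleton _
  · have htop : Ideal.span (Set.range (Fin.append u (Fin.cons v w : Fin (b + 1) → L))) = ⊤ := by
      refine Ideal.eq_top_of_isUnit_mem _ (Ideal.subset_span ⟨Fin.natAdd a 0, ?_⟩) hv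
      simp [Fin.append_right]
    rw [htop]
    trivial

/-! ## §3 The assembly: descent of the clause along a retraction -/

omit [Fact (Nat.Prime p)] in
/-- A ring map with a linear retraction is injective. [folklore] -/
theorem algebraMap_injective_of_retract {A B : Type} [CommRing A] [CommRing B] [Algebra A B]
    (ρ : B →ₗ[A] A) (hρ : ρ 1 = 1) : Function.Injective (algebraMap A B) := by
  intro a b hab
  have h : ∀ c : A, ρ (algebraMap A B c) = c := fun c => by
    rw [Algebra.algebraMap_eq_smul_one, LinearMap.map_smul, hρ, smul_eq_mul, mul_one]
  rw [← h a, ← h b, hab]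

omit [Fact (Nat.Prime p)] in
/-- If the extended ideal `(s)B` is not contained in the prime `P`, some image of `s` is a unit of `B_P`, so the
images generate the unit ideal of `B_P`. [folklore] -/
theorem span_images_eq_top_of_not_le {A B : Type} [CommRing A] [CommRing B] [Algebra A B] {d : ℕ}
    (s : Fin d → A) (P : Ideal B) [P.IsPrime]
    (h : ¬ (Ideal.span (Set.range s)).map (algebraMap A B) ≤ P) :
    Ideal.span (Set.range fun i => algebraMap B (Localization.AtPrime P) (algebraMap A B (s i))) = ⊤ := by
  have hex : ∃ i, algebraMap A B (s i) ∉ P := by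
    by_contra hall
    simp only [not_exists, not_not] at hall
    apply h
    rw [Ideal.map_span]
    refine Ideal.span_le.mpr ?_
    rintro _ ⟨_, ⟨i, rfl⟩, rfl⟩
    exact hall i
  obtain ⟨i, hi⟩ := hex
  refine Ideal.eq_top_of_isUnit_mem _ (Ideal.subset_span ⟨i, rfl⟩) ?_
  exact IsLocalization.map_units (Localization.AtPrime P) (⟨algebraMap A B (s i), show _ ∉ P from hi⟩ : P.primeCompl)

/-- **DESCENT OF THE CLAUSE ALONG A RETRACTION** (degree-zero descent, abstract form). Let `A` be a
Noetherian local ring of prime characteristic `p`, `A → B` a ring map to a Noetherian ring with an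
`A`-linear retraction `ρ` (`ρ 1 = 1`; e.g. `A = T₀ ⊆ T` a `ℤ`-graded ring with the degree-`0` projection),
and `s : Fin d → A`. Suppose that at every maximal ideal `P ⊇ (s)B` of `B` the local ring `B_P` satisfies the
crux's clause (every system of parameters weakly regular with Frobenius closed ideal — inline form) and the
images of `s` are dimension-theoretically part of a system of parameters (`dim B_P = d + e`,
`dim B_P/(s) = e`), and that at the maximal ideals `P ⊉ (s)B` the images of `s` still form a weakly regular
sequence. Then `s` is a weakly regular sequence on `A` and `(s)A` is Frobenius closed. Proof:
`stub_clauseOfRetract` (local-to-global on `B`, then the retraction), fed at each `P` by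
`images_clause_of_ringKrullDim` (`stub_extendSop` + `stub_partialSop`) or by `span_images_eq_top_of_not_le`.
No local cohomology, no F-finiteness, no flatness of `A → B`. [folklore; cf. card weighted-cone-deformation-descent step (ii)] -/
theorem clause_of_retract {A B : Type} [CommRing A] [CommRing B] [IsNoetherianRing A] [IsLocalRing A]
    [CharP A p] [Algebra A B] [IsNoetherianRing B] (ρ : B →ₗ[A] A) (hρ : ρ 1 = 1) {d : ℕ} (s : Fin d → A)
    (hgood : ∀ (P : Ideal B) [P.IsMaximal], (Ideal.span (Set.range s)).map (algebraMap A B) ≤ P →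
      (∀ n : ℕ, ringKrullDim (Localization.AtPrime P) = n → ∀ u : Fin n → Localization.AtPrime P,
        (Ideal.span (Set.range u)).radical.IsMaximal →
          IsWeaklyRegular (Localization.AtPrime P) (List.ofFn u) ∧
          ∀ y : Localization.AtPrime P, (∃ e : ℕ, y ^ p ^ e ∈ Ideal.span
            ((fun z : Localization.AtPrime P => z ^ p ^ e) ''
              (Ideal.span (Set.range u) : Set (Localization.AtPrime P)))) → y ∈ Ideal.span (Set.range u)) ∧
      ∃ e : ℕ, ringKrullDim (Localization.AtPrime P) = ((d + e : ℕ) : WithBot ℕ∞) ∧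
        ringKrullDim (Localization.AtPrime P ⧸ Ideal.span (Set.range fun i =>
          algebraMap B (Localization.AtPrime P) (algebraMap A B (s i)))) = (e : WithBot ℕ∞))
    (hoff : ∀ (P : Ideal B) [P.IsMaximal], ¬ (Ideal.span (Set.range s)).map (algebraMap A B) ≤ P →
      IsWeaklyRegular (Localization.AtPrime P)
        (List.ofFn fun i => algebraMap B (Localization.AtPrime P) (algebraMap A B (s i)))) :
    IsWeaklyRegular A (List.ofFn s) ∧ IsFrobeniusClosed p (Ideal.span (Set.range s)) := by
  haveI : CharP B p := charP_of_injective_algebraMap (algebraMap_injective_of_retract ρ hρ) p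
  refine RetractClause.stub_clauseOfRetract p A B ρ hρ d s fun P _ => ?_
  by_cases hP : (Ideal.span (Set.range s)).map (algebraMap A B) ≤ P
  · obtain ⟨hL, e, hdim, hquot⟩ := hgood P hP
    haveI : CharP (Localization.AtPrime P) p := charP_localization_atPrime p P
    exact images_clause_of_ringKrullDim p hL e _ hdim hquot
  · refine ⟨hoff P hP, fun y _ => ?_⟩
    rw [span_images_eq_top_of_not_le s P hP]
    trivial

/-- **The crux's clause for `A` from its retract-cover `B`**: under the hypotheses of `clause_of_retract` for
EVERY system of parameters `s` of the Noetherian local ring `A` (characteristic `p`), `A` satisfies the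
per-stalk clause of `FrobeniusLadder.FInjectiveMacaulayfication` verbatim (inline form). [folklore] -/
theorem inlineClause_of_retract {A B : Type} [CommRing A] [CommRing B] [IsNoetherianRing A] [IsLocalRing A]
    [CharP A p] [Algebra A B] [IsNoetherianRing B] (ρ : B →ₗ[A] A) (hρ : ρ 1 = 1)
    (h : ∀ (d : ℕ) (s : Fin d → A), IsSystemOfParameters s →
      (∀ (P : Ideal B) [P.IsMaximal], (Ideal.span (Set.range s)).map (algebraMap A B) ≤ P →
        (∀ n : ℕ, ringKrullDim (Localization.AtPrime P) = n → ∀ u : Fin n → Localization.AtPrime P,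
          (Ideal.span (Set.range u)).radical.IsMaximal →
            IsWeaklyRegular (Localization.AtPrime P) (List.ofFn u) ∧
            ∀ y : Localization.AtPrime P, (∃ e : ℕ, y ^ p ^ e ∈ Ideal.span
              ((fun z : Localization.AtPrime P => z ^ p ^ e) ''
                (Ideal.span (Set.range u) : Set (Localization.AtPrime P)))) → y ∈ Ideal.span (Set.range u)) ∧
        ∃ e : ℕ, ringKrullDim (Localization.AtPrime P) = ((d + e : ℕ) : WithBot ℕ∞) ∧
          ringKrullDim (Localization.AtPrime P ⧸ Ideal.span (Set.range fun i =>
            algebraMap B (Localization.AtPrime P) (algebraMap A B (s i)))) = (e : WithBot ℕ∞)) ∧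
      (∀ (P : Ideal B) [P.IsMaximal], ¬ (Ideal.span (Set.range s)).map (algebraMap A B) ≤ P →
        IsWeaklyRegular (Localization.AtPrime P)
          (List.ofFn fun i => algebraMap B (Localization.AtPrime P) (algebraMap A B (s i))))) :
    ∀ d : ℕ, ringKrullDim A = d → ∀ s : Fin d → A, (Ideal.span (Set.range s)).radical.IsMaximal →
      IsWeaklyRegular A (List.ofFn s) ∧
      ∀ y : A, (∃ e : ℕ, y ^ p ^ e ∈ Ideal.span ((fun z : A => z ^ p ^ e) ''
        (Ideal.span (Set.range s) : Set A))) → y ∈ Ideal.span (Set.range s) := by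
  intro d hd s hrad
  have hs : IsSystemOfParameters s := isSystemOfParameters_iff.mpr ⟨hd, hrad⟩
  obtain ⟨hgood, hoff⟩ := h d s hs
  obtain ⟨hW, hF⟩ := clause_of_retract p ρ hρ s (fun P _ hP => hgood P hP) (fun P _ hP => hoff P hP)
  exact ⟨hW, (isFrobeniusClosed_iff p).mp hF⟩

/-! ## Registered form -/

/-- **E4, registered helper-stub form** (fully explicit binders; = `clause_of_retract`): degree-zero descent of
the clause along an `A`-linear retraction `B → A`, `A` Noetherian local of characteristic `p`.
[folklore; cf. card weighted-cone-deformation-descent step (ii)] -/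
theorem stub_degreeZeroDescent : ∀ (p : ℕ) [Fact p.Prime] (A B : Type) [CommRing A] [CommRing B] [IsNoetherianRing A]
    [IsLocalRing A] [CharP A p] [Algebra A B] [IsNoetherianRing B] (ρ : B →ₗ[A] A), ρ 1 = 1 →
    ∀ (d : ℕ) (s : Fin d → A),
    (∀ (P : Ideal B) [P.IsMaximal], (Ideal.span (Set.range s)).map (algebraMap A B) ≤ P →
      (∀ n : ℕ, ringKrullDim (Localization.AtPrime P) = n → ∀ u : Fin n → Localization.AtPrime P,
        (Ideal.span (Set.range u)).radical.IsMaximal →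
          RingTheory.Sequence.IsWeaklyRegular (Localization.AtPrime P) (List.ofFn u) ∧
          ∀ y : Localization.AtPrime P, (∃ e : ℕ, y ^ p ^ e ∈ Ideal.span
            ((fun z : Localization.AtPrime P => z ^ p ^ e) ''
              (Ideal.span (Set.range u) : Set (Localization.AtPrime P)))) → y ∈ Ideal.span (Set.range u)) ∧
      ∃ e : ℕ, ringKrullDim (Localization.AtPrime P) = ((d + e : ℕ) : WithBot ℕ∞) ∧
        ringKrullDim (Localization.AtPrime P ⧸ Ideal.span (Set.range fun i =>
          algebraMap B (Localization.AtPrime P) (algebraMap A B (s i)))) = (e : WithBot ℕ∞)) →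
    (∀ (P : Ideal B) [P.IsMaximal], ¬ (Ideal.span (Set.range s)).map (algebraMap A B) ≤ P →
      RingTheory.Sequence.IsWeaklyRegular (Localization.AtPrime P)
        (List.ofFn fun i => algebraMap B (Localization.AtPrime P) (algebraMap A B (s i)))) →
    RingTheory.Sequence.IsWeaklyRegular A (List.ofFn s) ∧
      Literature.RingTheory.TightClosure.IsFrobeniusClosed p (Ideal.span (Set.range s)) :=
  fun p _ _ _ _ _ _ _ _ _ _ ρ hρ _ s hgood hoff =>
    clause_of_retract p ρ hρ s (fun P _ hP => hgood P hP) (fun P _ hP => hoff P hP)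

end Summit.ResolutionOfSingularities.ResolutionOfSingularities.Theorems.FInjectiveMacaulayfication.DegreeZeroDescent
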